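import Literature.NumberTheory.GaloisRepresentations.TameInertiaKummerProofs
import Literature.NumberTheory.GaloisRepresentations.DecompositionGroupOfCompletion
import Literature.NumberTheory.EllipticCurves.KummerUnramifiedConverse
import Literature.NumberTheory.EllipticCurves.KummerInertiaSurjectiveProofs
import Literature.NumberTheory.Automorphic.AdicCompletionLocalField
import Mathlib.RingTheory.DedekindDomain.Factorization
import HarnessLib

/-!
# Quadratic characters of the inertia group and the ramification of Kummer quadratic characters

Topic `NumberTheory/GaloisRepresentations`; a `Proofs`-style file (theorems only, no definition, no
named fact).  Two standard facts used whenever a finite-order Galois character is adjusted above a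
set of places by a quadratic (Kummer) twist:

* **Local** (`absInertia_eq_of_two_nsmul_eq_zero`).  Let `F` be a non-archimedean local field of
  *odd* residue characteristic and `χ₁, χ₂` two locally constant functions `Γ_F → ℚ/ℤ` which are
  additive and `2`-torsion on the inertia group `I_F = absInertia F`.  If both are non-trivial on
  `I_F`, they agree on `I_F`: the group of continuous characters of `I_F` of order dividing `2` is
  cyclic of order `2` (Serre, Invent. Math. 15 (1972), §1.3 and §1.7, Prop. 5:
  `Hom_cont(I_t, μ_d) = ⟨θ_d⟩ ≅ ℤ/d`, `p ∤ d`; here `d = 2`).  The proof runs Serre's argument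
  through the tree's `absInertia_exists_eq_mul_zpow` ("tame quotients of `I_F` of exponent prime
  to `p` are cyclic": `I_F = N · ⟨g⟩` for `N = ker χ₁ ∩ ker χ₂`), so that `χᵢ(ν gⁿ) = n χᵢ(g)` with
  `χᵢ(g)` the unique element `1/2` of order `2` of `ℚ/ℤ`
  (`addCircle_eq_zero_or_eq_coe_one_half`).
* **Global** (number field `k`, finite place `u`, `res : Γ_{k_u} → Γ_k` the restriction along the
  chosen embedding `k̄ → \bar{k_u}`, `I_{k_u} = absInertia (u.adicCompletion k)`):
  - `smul_eq_self_of_mem_absInertia_adicCompletion`: if `a ∈ 𝓞 k` and `d` are `u`-units, `res σ`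
    fixes every `d`-th root of `a` for `σ ∈ I_{k_u}` (Lang, *Fundamentals of Diophantine
    Geometry*, Ch. 6 Prop. 1.3, via the tree's `absoluteGaloisGroup_inertia_fixes_root_of_not_mem`
    and `I_{𝔓₀} = res (I_{k_u})`, `inertia_adicCompletionPrime_eq_map_absInertia`);
  - `exists_mem_absInertia_adicCompletion_smul_eq_pow_mul`: if `a` is a uniformiser at `u` and
    `u ∤ n`, every `ζⁱ η` (`ηⁿ = a`, `ζ` a primitive `n`-th root of unity) is `res σ • η` for some
    `σ ∈ I_{k_u}` (Serre 1972, §1.3: `θ_n` is onto; tree: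
    `exists_mem_absoluteGaloisGroup_inertia_smul_eq_pow_mul`);
  - `exists_quadraticCharacter_of_sq_eq`: the Kummer quadratic character of `√c`, as a locally
    constant additive `2`-torsion function `Γ_K → ℚ/ℤ` vanishing exactly on the stabiliser of `√c`;
  - `exists_ne_zero_valuation_eq_ite`: weak approximation in `𝓞 k` — an algebraic integer which
    is a uniformiser at prescribed places of a finite set `S` and a unit at the others (CRT);
  - `not_ringChar_residueField_adicCompletion_dvd`: the residue characteristic of `k_u` does not
    divide `n` when `u ∤ n`.

Mathlib has none of these (no inertia groups of local fields); `lean search` for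
`quadraticCharacter.*absInertia`, `two_nsmul.*absInertia`, `absInertia_adicCompletion` found
nothing in `Literature/`.

## References

* [SerreInventiones1972] J.-P. Serre, *Propriétés galoisiennes des points d'ordre fini des courbes
  elliptiques*, Invent. Math. 15 (1972), §1.3 (θ_d), §1.7 Prop. 5 (characters of `I_t`).
* [Lang1983] S. Lang, *Fundamentals of Diophantine Geometry* (1983), Ch. 6 Prop. 1.3.
* [NeukirchANT1999] J. Neukirch, *Algebraic Number Theory* (1999), Ch. II §9 Prop. (9.6).
-/

noncomputable section

open scoped NumberField Pointwise
open Field ValuativeRel IsDedekindDomain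

universe u

namespace Literature.NumberTheory.GaloisRepresentations

open GaloisRepresentations.IsNonarchimedeanLocalField

/-! ### The `2`-torsion of `ℚ/ℤ` -/

/-- The `2`-torsion of `ℚ/ℤ = AddCircle (1 : ℚ)` is `{0, 1/2}`. [folklore] -/
theorem addCircle_eq_zero_or_eq_coe_one_half {x : AddCircle (1 : ℚ)} (hx : 2 • x = 0) :
    x = 0 ∨ x = (((1 / 2 : ℚ)) : AddCircle (1 : ℚ)) := by
  obtain ⟨r, rfl⟩ := QuotientAddGroup.mk_surjective x
  change 2 • ((r : ℚ) : AddCircle (1 : ℚ)) = 0 at hx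
  rw [← AddCircle.coe_nsmul, AddCircle.coe_eq_zero_iff] at hx
  obtain ⟨n, hn⟩ := hx
  rw [zsmul_eq_mul, mul_one, nsmul_eq_mul, Nat.cast_ofNat] at hn
  obtain ⟨m, hm | hm⟩ := Int.even_or_odd' n
  · left
    change ((r : ℚ) : AddCircle (1 : ℚ)) = 0
    rw [AddCircle.coe_eq_zero_iff]
    refine ⟨m, ?_⟩
    rw [zsmul_eq_mul, mul_one]
    have h : (n : ℚ) = 2 * m := by exact_mod_cast hm
    linarith
  · right
    change ((r : ℚ) : AddCircle (1 : ℚ)) = _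
    rw [eq_comm, ← sub_eq_zero, ← AddCircle.coe_sub, AddCircle.coe_eq_zero_iff]
    refine ⟨-m, ?_⟩
    rw [zsmul_eq_mul, mul_one]
    have h : (n : ℚ) = 2 * m + 1 := by exact_mod_cast hm
    push_cast
    linarith

/-- `1/2 ≠ 0` in `ℚ/ℤ`. [folklore] -/
theorem addCircle_coe_one_half_ne_zero : (((1 / 2 : ℚ)) : AddCircle (1 : ℚ)) ≠ 0 := by
  rw [Ne, AddCircle.coe_eq_zero_iff]
  rintro ⟨n, hn⟩
  rw [zsmul_eq_mul, mul_one] at hn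
  have h2 : (2 : ℚ) * n = 1 := by rw [hn]; norm_num
  have h3 : (2 : ℤ) * n = 1 := by exact_mod_cast h2
  omega

/-- `1/2 + 1/2 = 0` in `ℚ/ℤ`. [folklore] -/
theorem addCircle_coe_one_half_add_self :
    (((1 / 2 : ℚ)) : AddCircle (1 : ℚ)) + (((1 / 2 : ℚ)) : AddCircle (1 : ℚ)) = 0 := by
  rw [← AddCircle.coe_add, add_halves, AddCircle.coe_period]

/-! ### Local: at most one non-trivial quadratic character on the inertia group -/

section Local

variable (F : Type*) [Field F] [ValuativeRel F] [TopologicalSpace F] [IsNonarchimedeanLocalField F]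

/-- **Uniqueness of the quadratic character of inertia (odd residue characteristic).**  Let
`χ₁, χ₂ : Γ_F → ℚ/ℤ` be locally constant, additive on `I_F` and killed by `2` on `I_F`.  If both
are non-trivial on `I_F`, then `χ₁ = χ₂` on `I_F`.  (The continuous characters of `I_F` of order
dividing `d`, `p ∤ d`, form the cyclic group `⟨θ_d⟩ ≅ ℤ/d`; for `d = 2` it has exactly one
non-trivial element.)  Proof: `N = ker χ₁ ∩ ker χ₂ ≤ I_F` contains the squares and the elements
restricting trivially to a finite Galois level (local constancy), so `I_F = N · ⟨g⟩`
(`absInertia_exists_eq_mul_zpow`) and `χᵢ(ν gⁿ) = n • χᵢ(g)` with `χᵢ(g) = 1/2`, the only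
non-zero `2`-torsion element of `ℚ/ℤ`.
Serre, Invent. Math. 15 (1972), §1.3 and §1.7, Prop. 5. [cite: SerreInventiones1972, §1.7 Prop. 5] -/
theorem absInertia_eq_of_two_nsmul_eq_zero (h2 : ¬ ringChar 𝓀[F] ∣ 2)
    {χ₁ χ₂ : absoluteGaloisGroup F → AddCircle (1 : ℚ)}
    (h₁c : IsLocallyConstant χ₁) (h₂c : IsLocallyConstant χ₂)
    (h₁ : ∀ σ ∈ absInertia F, ∀ τ ∈ absInertia F, χ₁ (σ * τ) = χ₁ σ + χ₁ τ)
    (h₂ : ∀ σ ∈ absInertia F, ∀ τ ∈ absInertia F, χ₂ (σ * τ) = χ₂ σ + χ₂ τ)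
    (h₁t : ∀ σ ∈ absInertia F, 2 • χ₁ σ = 0) (h₂t : ∀ σ ∈ absInertia F, 2 • χ₂ σ = 0)
    (h₁n : ∃ σ ∈ absInertia F, χ₁ σ ≠ 0) (h₂n : ∃ σ ∈ absInertia F, χ₂ σ ≠ 0) :
    ∀ σ ∈ absInertia F, χ₁ σ = χ₂ σ := by
  classical
  -- values at `1`
  have h₁one : χ₁ 1 = 0 := by
    have h := h₁ 1 (one_mem _) 1 (one_mem _)
    rw [mul_one] at h
    exact left_eq_add.mp h
  have h₂one : χ₂ 1 = 0 := by
    have h := h₂ 1 (one_mem _) 1 (one_mem _)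
    rw [mul_one] at h
    exact left_eq_add.mp h
  -- the characters as homomorphisms on the subgroup `I_F`
  let φ₁ : ↥(absInertia F) →* Multiplicative (AddCircle (1 : ℚ)) :=
    { toFun := fun τ => Multiplicative.ofAdd (χ₁ τ)
      map_one' := by rw [OneMemClass.coe_one, h₁one, ofAdd_zero]
      map_mul' := fun σ τ => by rw [Subgroup.coe_mul, h₁ σ σ.2 τ τ.2, ofAdd_add] }
  let φ₂ : ↥(absInertia F) →* Multiplicative (AddCircle (1 : ℚ)) :=
    { toFun := fun τ => Multiplicative.ofAdd (χ₂ τ)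
      map_one' := by rw [OneMemClass.coe_one, h₂one, ofAdd_zero]
      map_mul' := fun σ τ => by rw [Subgroup.coe_mul, h₂ σ σ.2 τ τ.2, ofAdd_add] }
  have hφ₁ : ∀ τ : ↥(absInertia F), φ₁ τ = Multiplicative.ofAdd (χ₁ τ) := fun _ => rfl
  have hφ₂ : ∀ τ : ↥(absInertia F), φ₂ τ = Multiplicative.ofAdd (χ₂ τ) := fun _ => rfl
  set N : Subgroup ↥(absInertia F) := φ₁.ker ⊓ φ₂.ker with hNdef
  have hNd : ∀ τ : ↥(absInertia F), τ ^ 2 ∈ N := fun τ =>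
    Subgroup.mem_inf.mpr
      ⟨MonoidHom.mem_ker.mpr (by rw [map_pow, hφ₁, ← ofAdd_nsmul, h₁t τ τ.2, ofAdd_zero]),
        MonoidHom.mem_ker.mpr (by rw [map_pow, hφ₂, ← ofAdd_nsmul, h₂t τ τ.2, ofAdd_zero])⟩
  -- local constancy: a finite Galois level `E` below which both characters vanish
  set U : Set (absoluteGaloisGroup F) := {σ | χ₁ σ = χ₁ 1} ∩ {σ | χ₂ σ = χ₂ 1} with hUdef
  have hUopen : IsOpen U := (h₁c.isOpen_fiber (χ₁ 1)).inter (h₂c.isOpen_fiber (χ₂ 1))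
  have h1U : (1 : absoluteGaloisGroup F) ∈ U := ⟨rfl, rfl⟩
  obtain ⟨E, hfin, hgal, hE⟩ := exists_isGalois_mem_of_restrict_eq_one F hUopen h1U
  haveI := hfin
  haveI := hgal
  have hNE : ∀ τ : ↥(absInertia F),
      absRestrictNormalHom E (τ : absoluteGaloisGroup F) = 1 → τ ∈ N := by
    intro τ hτ
    obtain ⟨hτ₁, hτ₂⟩ := hE _ hτ
    refine Subgroup.mem_inf.mpr ⟨MonoidHom.mem_ker.mpr ?_, MonoidHom.mem_ker.mpr ?_⟩
    · rw [hφ₁, show χ₁ τ = χ₁ 1 from hτ₁, h₁one, ofAdd_zero]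
    · rw [hφ₂, show χ₂ τ = χ₂ 1 from hτ₂, h₂one, ofAdd_zero]
  -- `I_F = N ⟨g⟩`
  obtain ⟨g, hg⟩ := absInertia_exists_eq_mul_zpow F h2 N hNd E hNE
  have heval₁ : ∀ (ν : ↥(absInertia F)) (_ : ν ∈ N) (n : ℤ),
      χ₁ ((ν * g ^ n : ↥(absInertia F)) : absoluteGaloisGroup F) = n • χ₁ g := fun ν hν n => by
    have h := hφ₁ (ν * g ^ n)
    rw [map_mul, map_zpow, show φ₁ ν = 1 from MonoidHom.mem_ker.mp (Subgroup.mem_inf.mp hν).1,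
      one_mul, hφ₁, ← ofAdd_zsmul] at h
    exact (Multiplicative.ofAdd.injective h).symm
  have heval₂ : ∀ (ν : ↥(absInertia F)) (_ : ν ∈ N) (n : ℤ),
      χ₂ ((ν * g ^ n : ↥(absInertia F)) : absoluteGaloisGroup F) = n • χ₂ g := fun ν hν n => by
    have h := hφ₂ (ν * g ^ n)
    rw [map_mul, map_zpow, show φ₂ ν = 1 from MonoidHom.mem_ker.mp (Subgroup.mem_inf.mp hν).2,
      one_mul, hφ₂, ← ofAdd_zsmul] at h
    exact (Multiplicative.ofAdd.injective h).symm
  -- `χᵢ(g) = 1/2`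
  have hg₁ : χ₁ g = (((1 / 2 : ℚ)) : AddCircle (1 : ℚ)) := by
    rcases addCircle_eq_zero_or_eq_coe_one_half (h₁t g g.2) with h | h
    · exfalso
      obtain ⟨σ, hσ, hσ0⟩ := h₁n
      obtain ⟨n, ν, hν, hσν⟩ := hg ⟨σ, hσ⟩
      apply hσ0
      have := heval₁ ν hν n
      rw [← hσν, h, zsmul_zero] at this
      exact this
    · exact h
  have hg₂ : χ₂ g = (((1 / 2 : ℚ)) : AddCircle (1 : ℚ)) := by
    rcases addCircle_eq_zero_or_eq_coe_one_half (h₂t g g.2) with h | h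
    · exfalso
      obtain ⟨σ, hσ, hσ0⟩ := h₂n
      obtain ⟨n, ν, hν, hσν⟩ := hg ⟨σ, hσ⟩
      apply hσ0
      have := heval₂ ν hν n
      rw [← hσν, h, zsmul_zero] at this
      exact this
    · exact h
  -- conclusion
  intro σ hσ
  obtain ⟨n, ν, hν, hσν⟩ := hg ⟨σ, hσ⟩
  have e₁ := heval₁ ν hν n
  have e₂ := heval₂ ν hν n
  rw [← hσν] at e₁ e₂
  change χ₁ σ = n • χ₁ g at e₁
  change χ₂ σ = n • χ₂ g at e₂
  rw [e₁, e₂, hg₁, hg₂]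

end Local

/-! ### The Kummer quadratic character of `√c` with values in `ℚ/ℤ` -/

section Quadratic

variable {K : Type*} [Field K]

/-- The stabiliser in `Γ_K` of an element `θ ∈ K̄` is open (it contains `Gal(K̄/K(θ))`, open for
the Krull topology as `K(θ)/K` is finite).  Neukirch, *Algebraic Number Theory*, Ch. IV §1.
[folklore] -/
theorem isOpen_setOf_smul_eq_self (θ : AlgebraicClosure K) :
    IsOpen {σ : absoluteGaloisGroup K | σ • θ = θ} := by
  have hθi : IsIntegral K θ := (Algebra.IsAlgebraic.isAlgebraic (R := K) θ).isIntegral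
  haveI : FiniteDimensional K (IntermediateField.adjoin K {θ}) :=
    IntermediateField.adjoin.finiteDimensional hθi
  have hopen : IsOpen {σ : absoluteGaloisGroup K |
      absoluteGaloisGroup.toAlgEquiv K σ ∈ (IntermediateField.adjoin K {θ}).fixingSubgroup} :=
    IntermediateField.fixingSubgroup_isOpen (IntermediateField.adjoin K {θ})
  -- the stabiliser is a union of cosets of this open subgroup
  rw [isOpen_iff_mem_nhds]
  intro σ hσ
  have hσ' : σ • θ = θ := hσ
  have hcont : Continuous fun τ : absoluteGaloisGroup K => σ⁻¹ * τ := continuous_const_mul σ⁻¹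
  have hpre := hopen.preimage hcont
  refine Filter.mem_of_superset (hpre.mem_nhds ?_) ?_
  · change absoluteGaloisGroup.toAlgEquiv K (σ⁻¹ * σ) ∈
      (IntermediateField.adjoin K {θ}).fixingSubgroup
    rw [inv_mul_cancel, map_one]
    exact Subgroup.one_mem _
  · intro τ hτ
    have hτ' : absoluteGaloisGroup.toAlgEquiv K (σ⁻¹ * τ) ∈
        (IntermediateField.adjoin K {θ}).fixingSubgroup := hτ
    have hfix : (σ⁻¹ * τ) • θ = θ := by
      rw [absoluteGaloisGroup.smul_def]
      exact (IntermediateField.mem_fixingSubgroup_iff _ _).mp hτ' θ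
        (IntermediateField.mem_adjoin_simple_self K θ)
    change τ • θ = θ
    have h := congrArg (σ • ·) hfix
    simp only [← mul_smul, mul_inv_cancel_left] at h
    rw [h, hσ']

/-- **The Kummer quadratic character of `√c`, with values in `ℚ/ℤ`.**  Let `K` be a field with
`2 ≠ 0`, `c ∈ K^×` and `θ ∈ K̄` with `θ² = c`.  Every `σ ∈ Γ_K` sends `θ` to `±θ`, and
`q(σ) = 0` if `σθ = θ`, `q(σ) = 1/2` if `σθ = -θ` defines a locally constant function
`q : Γ_K → ℚ/ℤ` which is additive (`q(στ) = q(σ) + q(τ)`), killed by `2`, and vanishes exactly on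
the stabiliser of `θ` (the character of `Gal(K(√c)/K) ↪ {0, 1/2}`).  Kummer theory for `n = 2`;
Neukirch, *Algebraic Number Theory*, Ch. IV §3. [folklore] -/
theorem exists_quadraticCharacter_of_sq_eq (h2 : (2 : K) ≠ 0) {c : K} (hc : c ≠ 0)
    {θ : AlgebraicClosure K} (hθ : θ ^ 2 = algebraMap K (AlgebraicClosure K) c) :
    ∃ q : absoluteGaloisGroup K → AddCircle (1 : ℚ),
      IsLocallyConstant q ∧ (∀ σ τ, q (σ * τ) = q σ + q τ) ∧ (∀ σ, 2 • q σ = 0) ∧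
      (∀ σ, q σ = 0 ↔ σ • θ = θ) := by
  classical
  have hθ0 : θ ≠ 0 := by
    rintro rfl
    rw [zero_pow two_ne_zero, eq_comm, map_eq_zero] at hθ
    exact hc hθ
  have hθneg : -θ ≠ θ := by
    intro h
    have h2' : (2 : AlgebraicClosure K) ≠ 0 := by
      have := (map_ne_zero (algebraMap K (AlgebraicClosure K))).mpr h2
      rwa [map_ofNat] at this
    apply hθ0
    have : (2 : AlgebraicClosure K) * θ = 0 := by rw [two_mul]; nth_rw 1 [← h]; rw [neg_add_cancel]
    exact (mul_eq_zero.mp this).resolve_left h2'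
  -- every `σ` sends `θ` to `±θ`
  have hpm : ∀ σ : absoluteGaloisGroup K, σ • θ = θ ∨ σ • θ = -θ := fun σ => by
    apply sq_eq_sq_iff_eq_or_eq_neg.mp
    rw [← smul_pow', hθ, smul_algebraMap]
  set S : Set (absoluteGaloisGroup K) := {σ | σ • θ = θ} with hSdef
  have hSopen : IsOpen S := isOpen_setOf_smul_eq_self θ
  -- the complement is open too: it is `{σ | σ • θ = -θ}`, a translate of `S`
  have hScopen : IsOpen Sᶜ := by
    rw [isOpen_iff_mem_nhds]
    intro σ₀ hσ₀
    have hσ₀' : σ₀ • θ = -θ := (hpm σ₀).resolve_left hσ₀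
    have hcont : Continuous fun τ : absoluteGaloisGroup K => σ₀⁻¹ * τ := continuous_const_mul σ₀⁻¹
    refine Filter.mem_of_superset ((hSopen.preimage hcont).mem_nhds ?_) ?_
    · change (σ₀⁻¹ * σ₀) • θ = θ
      rw [inv_mul_cancel, one_smul]
    · intro τ hτ hτS
      have hτ' : (σ₀⁻¹ * τ) • θ = θ := hτ
      have hτS' : τ • θ = θ := hτS
      rw [mul_smul, hτS', inv_smul_eq_iff, hσ₀'] at hτ'
      exact hθneg hτ'.symm
  refine ⟨fun σ => if σ • θ = θ then 0 else (((1 / 2 : ℚ)) : AddCircle (1 : ℚ)), ?_, ?_, ?_, ?_⟩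
  · -- locally constant
    refine (IsLocallyConstant.iff_exists_open _).mpr fun σ => ?_
    by_cases hσ : σ • θ = θ
    · exact ⟨S, hSopen, hσ, fun τ hτ => by
        have hτ' : τ • θ = θ := hτ
        simp only [hτ', hσ, if_true]⟩
    · exact ⟨Sᶜ, hScopen, hσ, fun τ hτ => by
        have hτ' : ¬ τ • θ = θ := hτ
        simp only [hτ', hσ, if_false]⟩
  · -- additive
    intro σ τ
    rcases hpm σ with hσ | hσ <;> rcases hpm τ with hτ | hτ
    · have hστ : (σ * τ) • θ = θ := by rw [mul_smul, hτ, hσ]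
      simp only [hστ, hσ, hτ, if_true, add_zero]
    · have hστ : (σ * τ) • θ = -θ := by rw [mul_smul, hτ, smul_neg, hσ]
      have hτ' : ¬ τ • θ = θ := by rw [hτ]; exact hθneg
      have hστ' : ¬ (σ * τ) • θ = θ := by rw [hστ]; exact hθneg
      simp only [hστ', hσ, hτ', if_true, if_false, zero_add]
    · have hστ : (σ * τ) • θ = -θ := by rw [mul_smul, hτ, hσ]
      have hσ' : ¬ σ • θ = θ := by rw [hσ]; exact hθneg
      have hστ' : ¬ (σ * τ) • θ = θ := by rw [hστ]; exact hθneg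
      simp only [hστ', hσ', hτ, if_true, if_false, add_zero]
    · have hστ : (σ * τ) • θ = θ := by rw [mul_smul, hτ, smul_neg, hσ, neg_neg]
      have hσ' : ¬ σ • θ = θ := by rw [hσ]; exact hθneg
      have hτ' : ¬ τ • θ = θ := by rw [hτ]; exact hθneg
      simp only [hστ, hσ', hτ', if_true, if_false]
      exact addCircle_coe_one_half_add_self.symm
  · -- `2`-torsion
    intro σ
    by_cases hσ : σ • θ = θ
    · simp only [hσ, if_true, nsmul_zero]
    · simp only [hσ, if_false, two_nsmul]
      exact addCircle_coe_one_half_add_self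
  · -- kernel
    intro σ
    by_cases hσ : σ • θ = θ
    · simp only [hσ, if_true]
    · simp only [hσ, if_false, iff_false]
      exact addCircle_coe_one_half_ne_zero

end Quadratic

/-! ### Global: the local inertia group of `k_u` on Kummer radicals -/

section Global

variable (k : Type u) [Field k] [NumberField k] (u : HeightOneSpectrum (𝓞 k))

/-- **Unramified Kummer radicals, local form.**  If `a ∈ 𝓞 k` and `d` are units at the finite
place `u`, then for every `σ` in the inertia group `I_{k_u} = absInertia (u.adicCompletion k)` of
the completion, `res σ` fixes every `d`-th root `α ∈ k̄` of `a` (`res : Γ_{k_u} → Γ_k` the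
restriction along the chosen embedding `k̄ → \bar{k_u}`): `res (I_{k_u})` is the inertia group
of the prime `𝔓₀` above `u` cut out by the embedding (`inertia_adicCompletionPrime_eq_map_absInertia`)
and that inertia group fixes `α` (`absoluteGaloisGroup_inertia_fixes_root_of_not_mem`).
Lang, *Fundamentals of Diophantine Geometry*, Ch. 6 Prop. 1.3. [cite: Lang1983, Ch. 6 Prop. 1.3] -/
theorem smul_eq_self_of_mem_absInertia_adicCompletion {d : ℕ} {a : 𝓞 k}
    (hau : a ∉ u.asIdeal) (hdu : (d : 𝓞 k) ∉ u.asIdeal)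
    {α : AlgebraicClosure k} (hα : α ^ d = algebraMap (𝓞 k) (AlgebraicClosure k) a)
    {σ : absoluteGaloisGroup (u.adicCompletion k)} (hσ : σ ∈ absInertia (u.adicCompletion k)) :
    absGaloisRestrict k (u.adicCompletion k) σ • α = α := by
  have hmem : absGaloisRestrict k (u.adicCompletion k) σ ∈
      (adicCompletionPrime k u).inertia (absoluteGaloisGroup k) := by
    rw [inertia_adicCompletionPrime_eq_map_absInertia]
    exact ⟨σ, hσ, rfl⟩
  exact EllipticCurves.absoluteGaloisGroup_inertia_fixes_root_of_not_mem u hau hdu hα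
    (adicCompletionPrime_mem_primesAbove k u) hmem

/-- **The Kummer character of a uniformiser is onto, local form.**  If `a ∈ k` is a uniformiser
at `u` (`u(a) = exp (-1)`), `u ∤ n`, `ζ ∈ k̄` is a primitive `n`-th root of unity and `ηⁿ = a`,
then every `ζⁱ η` is `res σ • η` for some `σ` in the local inertia group
`I_{k_u} = absInertia (u.adicCompletion k)` (`k_u(a^{1/n})` is totally ramified of degree `n` over
the maximal unramified extension).  From `exists_mem_absoluteGaloisGroup_inertia_smul_eq_pow_mul`
and `inertia_adicCompletionPrime_eq_map_absInertia`.
Serre, Invent. Math. 15 (1972), §1.3. [cite: SerreInventiones1972, §1.3] -/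
theorem exists_mem_absInertia_adicCompletion_smul_eq_pow_mul {n : ℕ} (hn : 0 < n)
    {ζ : AlgebraicClosure k} (hζ : IsPrimitiveRoot ζ n) (hnu : (n : 𝓞 k) ∉ u.asIdeal)
    {a : k} (ha : u.valuation k a = WithZero.exp (-1 : ℤ))
    {η : AlgebraicClosure k} (hη : η ^ n = algebraMap k (AlgebraicClosure k) a) (i : ℕ) :
    ∃ σ ∈ absInertia (u.adicCompletion k),
      absGaloisRestrict k (u.adicCompletion k) σ • η = ζ ^ i * η := by
  obtain ⟨τ, hτ, hτη⟩ := EllipticCurves.exists_mem_absoluteGaloisGroup_inertia_smul_eq_pow_mul hn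
    hζ u hnu ha hη (adicCompletionPrime_mem_primesAbove k u) i
  rw [inertia_adicCompletionPrime_eq_map_absInertia] at hτ
  obtain ⟨σ, hσ, rfl⟩ := hτ
  exact ⟨σ, hσ, hτη⟩

/-- The residue characteristic of `k_u` (for the `ValuativeRel` structure of
`AdicCompletionLocalField`) does not divide `n` when `u ∤ n`: otherwise `n` is a non-unit of
`𝒪[k_u]`, i.e. `u(n) < 1`, i.e. `n ∈ u`. [folklore] -/
theorem not_ringChar_residueField_adicCompletion_dvd {n : ℕ} (hnu : (n : 𝓞 k) ∉ u.asIdeal) :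
    ¬ ringChar 𝓀[u.adicCompletion k] ∣ n := by
  intro h
  have h0 : ((n : ℕ) : 𝓀[u.adicCompletion k]) = 0 := (ringChar.spec 𝓀[u.adicCompletion k] n).2 h
  have h1 : ¬ IsUnit ((n : ℕ) : 𝒪[u.adicCompletion k]) := fun hu' => by
    have h' := hu'.map (IsLocalRing.residue 𝒪[u.adicCompletion k])
    rw [map_natCast] at h'
    exact h'.ne_zero h0
  rw [Valuation.Integer.not_isUnit_iff_valuation_lt_one] at h1
  have h2 : Valued.v (((n : ℕ) : 𝒪[u.adicCompletion k]) : u.adicCompletion k) < 1 :=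
    (Valuation.vlt_one_iff
      (Valued.v : Valuation (u.adicCompletion k) (WithZero (Multiplicative ℤ)))).mp
      ((Valuation.vlt_one_iff (ValuativeRel.valuation (u.adicCompletion k))).mpr h1)
  have h3 : (((n : ℕ) : 𝒪[u.adicCompletion k]) : u.adicCompletion k) =
      ((algebraMap (𝓞 k) k n : k) : u.adicCompletion k) := by
    rw [SubringClass.coe_natCast, map_natCast]
    exact (map_natCast (algebraMap k (u.adicCompletion k)) n).symm
  rw [h3, HeightOneSpectrum.valuedAdicCompletion_eq_valuation',
    HeightOneSpectrum.valuation_lt_one_iff_mem] at h2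
  exact hnu h2

/-- **Weak approximation in `𝓞 k` (CRT): a uniformiser at prescribed places, a unit at the
others.**  For a finite set `S` of finite places and a predicate `T` on places there is a non-zero
`γ ∈ 𝓞 k` with `u(γ) = exp (-1)` (i.e. `ord_u γ = 1`) for `u ∈ S` with `T u`, and `γ ∉ u` for
`u ∈ S` with `¬ T u`: solve `γ ≡ π_u (mod u²)`, resp. `γ ≡ 1 (mod u²)`, by the Chinese remainder
theorem (`IsDedekindDomain.exists_forall_sub_mem_ideal`). Neukirch, *Algebraic Number Theory*,
Ch. I (3.6) and Ch. II (3.4). [folklore] -/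
theorem exists_ne_zero_valuation_eq_ite (S : Finset (HeightOneSpectrum (𝓞 k)))
    (T : HeightOneSpectrum (𝓞 k) → Prop) :
    ∃ γ : 𝓞 k, γ ≠ 0 ∧
      (∀ u ∈ S, T u → u.valuation k (γ : k) = WithZero.exp (-1 : ℤ)) ∧
      (∀ u ∈ S, ¬ T u → γ ∉ u.asIdeal) := by
  classical
  rcases S.eq_empty_or_nonempty with rfl | hS
  · exact ⟨1, one_ne_zero, fun u hu => absurd hu (Finset.notMem_empty u),
      fun u hu => absurd hu (Finset.notMem_empty u)⟩
  -- uniformisers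
  have hπ : ∀ u : HeightOneSpectrum (𝓞 k), ∃ π : 𝓞 k, u.intValuation π = WithZero.exp (-1 : ℤ) :=
    fun u => u.intValuation_exists_uniformizer
  choose π hπ using hπ
  obtain ⟨y, hy⟩ := IsDedekindDomain.exists_forall_sub_mem_ideal (s := S)
    (fun u : HeightOneSpectrum (𝓞 k) => u.asIdeal) (fun _ => 2) (fun u _ => u.prime)
    (fun u _ w _ huw => fun h => huw (HeightOneSpectrum.ext h))
    (fun u => if T u.1 then π u.1 else 1)
  have hval : ∀ u ∈ S, T u → u.intValuation y = WithZero.exp (-1 : ℤ) := by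
    intro u hu hT
    have h := hy u hu
    rw [if_pos hT] at h
    have hle : u.intValuation (y - π u) ≤ WithZero.exp (-(2 : ℕ) : ℤ) :=
      (u.intValuation_le_pow_iff_mem _ 2).mpr h
    have hlt : u.intValuation (y - π u) < u.intValuation (π u) := by
      rw [hπ u]
      exact hle.trans_lt (WithZero.exp_lt_exp.mpr (by norm_num))
    rw [← sub_add_cancel y (π u), Valuation.map_add_eq_of_lt_right _ hlt, hπ u]
  have hunit : ∀ u ∈ S, ¬ T u → y ∉ u.asIdeal := by
    intro u hu hT hyu
    have h := hy u hu
    rw [if_neg hT] at h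
    have h' : y - 1 ∈ u.asIdeal := Ideal.pow_le_self two_ne_zero h
    have h1 : (1 : 𝓞 k) ∈ u.asIdeal := by
      have := u.asIdeal.sub_mem hyu h'
      rwa [sub_sub_cancel] at this
    exact u.isPrime.ne_top ((Ideal.eq_top_iff_one _).mpr h1)
  refine ⟨y, ?_, fun u hu hT => ?_, hunit⟩
  · obtain ⟨u, hu⟩ := hS
    by_cases hT : T u
    · intro hy0
      have h := hval u hu hT
      rw [hy0, map_zero] at h
      exact WithZero.zero_ne_coe h
    · intro hy0
      exact hunit u hu hT (hy0 ▸ u.asIdeal.zero_mem)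
  · rw [HeightOneSpectrum.valuation_of_algebraMap]
    exact hval u hu hT

end Global

end Literature.NumberTheory.GaloisRepresentations

end
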